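import Summits.BirchSwinnertonDyer.BirchSwinnertonDyer.Theorems.CongruentShaFreeCutLinkBStructure

/-! # Route `CongruentShaFreeCut` (rung S2) — crux `AnalyticRankOneOfRankOneFiniteShaTwo`
(stmt-BirchSwinnertonDyer-19080): the two HALVES of Link B — the half at non-torsion Heegner points
is Gross–Zagier–Kolyvagin + Link A; the registered stub is EQUIVALENT to its half at torsion Heegner
points («corank 1 ∧ y_K torsion ⟹ F(0) = 0»)

Cell `bsd-cn100`, prover seat `bsd-cn100-s2-c3` g4. Supports, does not close,
stmt-BirchSwinnertonDyer-19080. HONEST FRAMING: theorems ABOUT the open Link B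
(`CongruentShaFreeCutTwoAdicLinks.TwoAdicCharValueEqHeegnerLogSq`, registered stub
`stub_twoAdicCharValueEqHeegnerLogSq`); CONDITIONAL on the hypotheses named (Link A — itself a kernel
theorem modulo Poitou–Tate, p432373 —, Gross–Zagier, Gross–Zagier + Kolyvagin over `K`); nothing about
BSD, crux B, the leaf or the congruent number problem is proved and Link B is not proved. Sequel of
`CongruentShaFreeCutLinkBStructure` (p433291: `CharValueEqLogSqAt … P` ⟺ `𝔛` `Λ`-torsion ∧
`char 𝔛 = (F)` ∧ (`F(0) = 0 ↔ P` torsion)).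

## What is proved

* **`twoAdicCharValue_of_not_isOfFinAddOrder`** — the EASY HALF: at every datum of Link B and every
  Heegner point `P ∈ E_n(K)` which is NOT torsion, the conclusion `CharValueEqLogSqAt E_n 2 κ v̄ γ ι P`
  of Link B HOLDS, granted Link A, Gross–Zagier (`analyticRankEK_eq_one_iff_heegner_nonTorsion`,
  `analyticRankEK_eq_one_iff_LDerivEK_ne_zero`) and Kolyvagin over `K`
  (`mordellWeilRank_eq_one_of_LDerivEK_ne_zero`): `P` non-torsion ⟹ `ord_{s=1} L(E_n/K, s) = 1` ⟹
  `rank E_n(K) = 1 ∧ Ш(E_n/K)` finite ⟹ (Link A) `F(0) ≠ 0` ⟹ `F(0) = u · (log_ω P)²` with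
  `u = F(0)/(log_ω P)² ≠ 0`. NO corank hypothesis is needed.
* **`linkB_iff_torsionHalf`** — consequently the registered Link B is EQUIVALENT (granted the same
  facts) to its TORSION HALF: «for square-free `n` and every datum `(K, N, ι, v, v̄, κ, γ)` with
  `corank_{ℤ₂} Sel_{2^∞}(E_n/K) = 1`, if some Heegner point `P ∈ E_n(K)` of level `N` is TORSION then
  `𝔛 = X_{v̄}^{∅}(E_n[2^∞]/K_∞)` is `Λ`-torsion and its characteristic ideal has a generator with
  `F(0) = 0`» — a statement whose hypothesis «corank 1 ∧ y_K torsion» is expected to be VACUOUS (it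
  contradicts the `2`-converse over `K`), i.e. exactly the contrapositive packaging of the `p`-converse
  content «`𝔛` torsion with `F(0) ≠ 0` (or `𝔛` not torsion) ⟹ `y_K` non-torsion». This is the
  kernel form of the census line «the research content of 19080 is Link B»: Link B = (GZK + Link A)
  ∧ (torsion half), and only the torsion half is open.
[cite: GrossZagier1986, Thm. I.6.3 with V.§2 (y_K non-torsion ↔ L'(E/K,1) ≠ 0)]
[cite: CastellaGrossiLeeSkinner2022, §5.2 (proof of Thm. 5.2.1: shape of a BDP-type p-converse)] -/

set_option linter.dupNamespace false

noncomputable section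

open scoped Classical

namespace Summit.BirchSwinnertonDyer.BirchSwinnertonDyer.Theorems.CongruentShaFreeCutLinkBHalves

open WeierstrassCurve NumberField IsDedekindDomain Field Literature.NumberTheory.EllipticCurves
  Literature.NumberTheory.EllipticCurves.Castella2018
open Summit.BirchSwinnertonDyer.BirchSwinnertonDyer.Theorems.CongruentShaFreeCutTwoAdicLinks
open Summit.BirchSwinnertonDyer.BirchSwinnertonDyer.Theorems.CongruentShaFreeCutLinkBStructure

/-- **The easy half of Link B: at a NON-TORSION Heegner point, Link B's conclusion follows from Link A
and Gross–Zagier–Kolyvagin.** For square-free `n`, a datum `(K, N, ι, v, v̄, κ, γ)` as in the links and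
a Heegner point `P ∈ E_n(K)` of level `N = N(E_n)` of INFINITE order: `CharValueEqLogSqAt E_n 2 κ v̄ γ ι P`.
Proof: `hGZ` turns "`P` non-torsion" into `ord_{s=1} L(E_n/K, s) = 1`; Gross–Zagier + Kolyvagin
(`mordellWeilRank_eq_one_of_analyticRankEK_eq_one` from `hGZ'`, `hKoly`) give `rank E_n(K) = 1` and
`Ш(E_n/K)` finite; Link A (`hA`) gives a generator with `F(0) ≠ 0`; and
`charValueEqLogSqAt_of_hasCharValuationAt_of_not_isOfFinAddOrder` concludes (`u = F(0)/(log_ω P)²`).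
No Selmer-corank hypothesis is used. CONDITIONAL on `hA`, `hGZ`, `hGZ'`, `hKoly`; credits nothing.
[cite: GrossZagier1986, Thm. I.6.3 with V.§2] [cite: CastellaGrossiLeeSkinner2022, §5.2 (shape)] -/
theorem twoAdicCharValue_of_not_isOfFinAddOrder
    (hA : TwoAdicControlOfRankOne)
    (hGZ : ∀ (W : WeierstrassCurve ℚ) (N : ℕ) [NeZero N] (K : Type) [Field K] [NumberField K],
      analyticRankEK_eq_one_iff_heegner_nonTorsion W N K)
    (hGZ' : ∀ (W : WeierstrassCurve ℚ) (N : ℕ) [NeZero N] (K : Type) [Field K] [NumberField K],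
      analyticRankEK_eq_one_iff_LDerivEK_ne_zero W N K)
    (hKoly : ∀ (W : WeierstrassCurve ℚ) (K : Type) [Field K] [NumberField K],
      mordellWeilRank_eq_one_of_LDerivEK_ne_zero W K)
    ⦃n : ℕ⦄ (hn : Squarefree n) [(congruentNumberCurve n).IsElliptic]
    [(congruentNumberCurve n).IsGloballyMinimal]
    (K : Type) [Field K] [NumberField K] (N : ℕ) [NeZero N]
    (hN : (congruentNumberCurve n).conductorNorm ℤ = N) (hK : IsImaginaryQuadratic K)
    (hHN : SatisfiesHeegnerHypothesis N K) (hH2 : SatisfiesHeegnerHypothesis 2 K)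
    (ι : K →+* ℚ_[2]) (v vbar : HeightOneSpectrum (𝓞 K))
    (hv : ∀ x : 𝓞 K, x ∈ v.asIdeal ↔ ‖ι (x : K)‖ < 1) (hvbar : ((2 : ℕ) : 𝓞 K) ∈ vbar.asIdeal)
    (hne : vbar ≠ v) (κ : ZpExtension K 2) (hκ : κ.IsAnticyclotomic)
    (γ : absoluteGaloisGroup K) [Fact (κ.IsTopGenerator γ)]
    (P : ((congruentNumberCurve n).baseChange K).toAffine.Point)
    (hP : IsHeegnerPoint N (congruentNumberCurve n) K P) (hPnt : ¬ IsOfFinAddOrder P) :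
    AcPConverseLinks.CharValueEqLogSqAt (congruentNumberCurve n) 2 κ vbar γ ι P := by
  haveI : NeZero ((congruentNumberCurve n).conductorNorm ℤ) := ⟨hN ▸ NeZero.ne N⟩
  -- `P` non-torsion ⟹ `ord_{s=1} L(E_n/K, s) = 1` ⟹ `rank E_n(K) = 1 ∧ Ш(E_n/K)` finite
  have hr : analyticRankEK (congruentNumberCurve n) K = 1 :=
    (hGZ (congruentNumberCurve n) N K hK hN hHN hP).mpr hPnt
  obtain ⟨hrk, hShaFin⟩ := mordellWeilRank_eq_one_of_analyticRankEK_eq_one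
    (W := congruentNumberCurve n) (N := N) (K := K)
    (hGZ' (congruentNumberCurve n) N K) (hKoly (congruentNumberCurve n) K) hK hN hHN hr
  haveI : Finite ((congruentNumberCurve n).baseChange K).sha := hShaFin
  have hshaK : Finite
      (AddCommGroup.primaryComponent ((congruentNumberCurve n).baseChange K).sha 2) :=
    inferInstance
  -- Link A at the datum, then the generic converse of `not_isOfFinAddOrder_of_links`
  exact charValueEqLogSqAt_of_hasCharValuationAt_of_not_isOfFinAddOrder ι
    (hA hn K N hN hK hHN hH2 ι v vbar hv hvbar hne κ hκ γ hrk hshaK) hPnt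

/-- **Link B ⟺ its torsion half** (granted Link A, Gross–Zagier and Gross–Zagier + Kolyvagin over
`K`). The registered `TwoAdicCharValueEqHeegnerLogSq` holds iff: for every square-free `n`, every datum
`(K, N, ι, v, v̄, κ, γ)` of the links with `corank_{ℤ₂} Sel_{2^∞}(E_n/K) = 1` and every Heegner point
`P ∈ E_n(K)` of level `N` which IS torsion, `𝔛 = X_{v̄}^{∅}(E_n[2^∞]/K_∞)` is `Λ`-torsion and
`char_Λ 𝔛 = (F)` with `F(0) = 0`. (`→`: `charValueEqLogSqAt_iff`; `←`: at a torsion `P` the torsion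
half with `charValueEqLogSqAt_iff`, at a non-torsion `P` the easy half
`twoAdicCharValue_of_not_isOfFinAddOrder`.) So, modulo Link A (= Poitou–Tate, p432373) and GZK, the
open content of Link B is exactly «corank 1 ∧ y_K torsion ⟹ the characteristic series of the BDP
Selmer dual vanishes at 𝟙» — the contrapositive packaging of the `2`-adic `p`-converse step at the
additive prime. CONDITIONAL; credits nothing. [cite: GrossZagier1986, Thm. I.6.3 with V.§2]
[cite: CastellaGrossiLeeSkinner2022, §5.2 (shape)] -/
theorem linkB_iff_torsionHalf
    (hA : TwoAdicControlOfRankOne)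
    (hGZ : ∀ (W : WeierstrassCurve ℚ) (N : ℕ) [NeZero N] (K : Type) [Field K] [NumberField K],
      analyticRankEK_eq_one_iff_heegner_nonTorsion W N K)
    (hGZ' : ∀ (W : WeierstrassCurve ℚ) (N : ℕ) [NeZero N] (K : Type) [Field K] [NumberField K],
      analyticRankEK_eq_one_iff_LDerivEK_ne_zero W N K)
    (hKoly : ∀ (W : WeierstrassCurve ℚ) (K : Type) [Field K] [NumberField K],
      mordellWeilRank_eq_one_of_LDerivEK_ne_zero W K) :
    TwoAdicCharValueEqHeegnerLogSq ↔
      ∀ ⦃n : ℕ⦄, Squarefree n →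
        ∀ [(congruentNumberCurve n).IsElliptic] [(congruentNumberCurve n).IsGloballyMinimal]
          (K : Type) [Field K] [NumberField K] (N : ℕ) [NeZero N],
        (congruentNumberCurve n).conductorNorm ℤ = N → IsImaginaryQuadratic K →
          SatisfiesHeegnerHypothesis N K → SatisfiesHeegnerHypothesis 2 K →
        ∀ (ι : K →+* ℚ_[2]) (v vbar : HeightOneSpectrum (𝓞 K)),
          (∀ x : 𝓞 K, x ∈ v.asIdeal ↔ ‖ι (x : K)‖ < 1) →
          ((2 : ℕ) : 𝓞 K) ∈ vbar.asIdeal → vbar ≠ v →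
        ∀ (κ : ZpExtension K 2), κ.IsAnticyclotomic →
        ∀ (γ : absoluteGaloisGroup K) [Fact (κ.IsTopGenerator γ)],
          ((congruentNumberCurve n).baseChange K).selmerCorank 2 = 1 →
        ∀ (P : ((congruentNumberCurve n).baseChange K).toAffine.Point),
          IsHeegnerPoint N (congruentNumberCurve n) K P → IsOfFinAddOrder P →
            Module.IsTorsion (IwasawaAlgebra 2)
                (AcSelmer.XAc ((congruentNumberCurve n).baseChange K) 2 κ vbar ∅ γ) ∧
              ∃ F : IwasawaAlgebra 2,
                AcSelmer.XAc.charIdeal ((congruentNumberCurve n).baseChange K) 2 κ vbar ∅ γ =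
                    Ideal.span {F} ∧ PowerSeries.constantCoeff F = 0 := by
  constructor
  · intro hB n hn _ _ K _ _ N _ hN hK hHN hH2 ι v vbar hv hvbar hne κ hκ γ _ hSel P hP hPt
    obtain ⟨htors, F, hF, hiff⟩ := (charValueEqLogSqAt_iff (congruentNumberCurve n) 2 κ vbar γ ι P).mp
      (hB hn K N hN hK hHN hH2 ι v vbar hv hvbar hne κ hκ γ hSel P hP)
    exact ⟨htors, F, hF, hiff.mpr hPt⟩
  · intro hH n hn _ _ K _ _ N _ hN hK hHN hH2 ι v vbar hv hvbar hne κ hκ γ _ hSel P hP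
    by_cases hPt : IsOfFinAddOrder P
    · obtain ⟨htors, F, hF, hF0⟩ :=
        hH hn K N hN hK hHN hH2 ι v vbar hv hvbar hne κ hκ γ hSel P hP hPt
      exact (charValueEqLogSqAt_iff (congruentNumberCurve n) 2 κ vbar γ ι P).mpr
        ⟨htors, F, hF, ⟨fun _ ↦ hPt, fun _ ↦ hF0⟩⟩
    · exact twoAdicCharValue_of_not_isOfFinAddOrder hA hGZ hGZ' hKoly hn K N hN hK hHN hH2 ι v vbar
        hv hvbar hne κ hκ γ P hP hPt

end Summit.BirchSwinnertonDyer.BirchSwinnertonDyer.Theorems.CongruentShaFreeCutLinkBHalves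

end
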